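import Literature.NumberTheory.EllipticCurves.TianYuanZhang2017.CurveAFourTorsion
import Literature.NumberTheory.EllipticCurves.TwoDescent
import HarnessLib

/-!
# Explicit `2`-division algebra on TYZ's curve `A : Y² = X³ + 4X`: duplication, translation by `A[2]`, and the SIGN CHARACTERS of the square roots
# `g⁰ = (x² − 4)/(2y)`, `g⁺ = (x² − 4ix + 4)/(2y)` (crux stmt-BirchSwinnertonDyer-20509 `RamifiedOffTYZOfFacts`, line `offtyz-v7`, LEAD g29, cycle 30, part 2a)

HONEST FRAMING (cell `bsd-print-cf2`, route `PrintCf2`; `--supports stmt-BirchSwinnertonDyer-20509`; theorems only, `def`-free, no `sorry`).  BSD is not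
proved by any of this; no class is closed by this file.  This is the algebraic engine of the EXACT DESCENT LEMMA (memo `Lines/offtyz_v7_ExactDescent.md` §1,
proof 2), used by `…GenusPeriodTraceNorm` (the trace–norm theorem) and `…GenusPeriodDescent` (the descended identities `κ_{ℍ′}(Z(d)) = ([N₁],[N₀])`):

* §1 over any field `K` of characteristic `0` (with `i ∈ K`, `i² = −1` where needed): `a`-invariants of `A/K`; tangent slope `(3u² + 4)/(2v)`;
  duplication `x(2Q) = ((u² − 4)/(2v))²`, `x(2Q) − 2i = ((u² − 4iu + 4)/(2v))²`; chord coordinates of `Q + τ(1)` (`τ(1) = (0,0)`) and `Q + T⁺`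
  (`T⁺ = (2i,0)`): `(4/u, −4v/u²)`, `((2iu − 4)/(u − 2i), 8v/(u − 2i)²)`.
* §2 point-level forms (`2•Q = (X,Y) ⟹ X − 2i = g⁺(Q)²`, `X = g⁰(Q)²`; `Q + τ(1)`, `Q + T⁺` as points; `τ(1) + T⁺ = T⁻`).
* §5 (`sqUnits_eq_one`, `exists_two_smul_eq`): over an algebraically closed field every square class is trivial and every point of `A` is
  `2`-divisible (tree `exists_add_self_of_twoDescentComponent_eq_one`) — the halves used by the trace–norm theorem.
* §3 the sign characters: `g⁺(Q + τ(1)) = −g⁺(Q)`, `g⁺(Q + T⁺) = g⁺(Q)`, `g⁰(Q + τ(1)) = g⁰(Q)`, `g⁰(Q + T⁺) = −g⁰(Q)` — the Weil pairing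
  `e₂(·, T⁺)`, `e₂(·, τ(1))` in coordinates; they make `σ ↦ g(σQ)/g(Q)` a CHARACTER, which is the heart of the trace–norm theorem.

References: [cite: SilvermanAEC2009, III.2.3 (group law, duplication formula), III.8 (Weil pairing), Prop. X.1.4 (proof)];
[cite: TianYuanZhang2017, §3.1 (p0010 L11: A ≅ (X₀(32), ∞)), Lemma 3.16 (p0017 L98–L101: A[2])]; tree `TianYuanZhang2017/CurveAFourTorsion`.
-/

noncomputable section

open scoped Classical

open WeierstrassCurve WeierstrassCurve.Affine WeierstrassCurve.Affine.Point
  Literature.NumberTheory.EllipticCurves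
  Literature.NumberTheory.EllipticCurves.TianYuanZhang2017

set_option autoImplicit false

namespace Summit.BirchSwinnertonDyer.PrintCf2.GenusPeriodTraceNorm

/-! ## §1 Explicit algebra on `A : Y² = X³ + 4X` -/

variable {K : Type} [Field K] [CharZero K]

/-- `a₁(A) = 0`. [folklore] -/
theorem A_a₁ : (curveA.baseChange K).toAffine.a₁ = 0 := by simp [curveA, WeierstrassCurve.baseChange]
/-- `a₂(A) = 0`. [folklore] -/
theorem A_a₂ : (curveA.baseChange K).toAffine.a₂ = 0 := by simp [curveA, WeierstrassCurve.baseChange]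
/-- `a₃(A) = 0`. [folklore] -/
theorem A_a₃ : (curveA.baseChange K).toAffine.a₃ = 0 := by simp [curveA, WeierstrassCurve.baseChange]
/-- `a₄(A) = 4`. [folklore] -/
theorem A_a₄ : (curveA.baseChange K).toAffine.a₄ = 4 := by
  simp [curveA, WeierstrassCurve.baseChange]

/-- The tangent slope at a non-`2`-torsion point `(u, v)` of `A` is `(3u² + 4)/(2v)`. [cite: SilvermanAEC2009, III.2.3] -/
theorem A_slope_self {u v : K} (hv : v ≠ 0) :
    (curveA.baseChange K).toAffine.slope u u v v = (3 * u ^ 2 + 4) / (2 * v) := by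
  have hv' : v ≠ (curveA.baseChange K).toAffine.negY u v := by
    rw [curveA_negY]; intro h; exact hv (CharZero.eq_neg_self_iff.mp h)
  rw [slope_of_Y_ne rfl hv', curveA_negY, A_a₁, A_a₂, A_a₄]
  ring

/-- **Doubling, coordinate at `T⁺ = (2i, 0)`**: `x(2Q) − 2i = ((u² − 4iu + 4)/(2v))²`. [cite: SilvermanAEC2009, III.2.3, X.1 (proof of Prop. 1.4)] -/
theorem A_addX_self_sub_twoIm {im u v : K} (him : im ^ 2 = -1) (hv : v ≠ 0) (heq : v ^ 2 = u ^ 3 + 4 * u) :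
    (curveA.baseChange K).toAffine.addX u u ((3 * u ^ 2 + 4) / (2 * v)) - 2 * im =
      ((u ^ 2 - 4 * im * u + 4) / (2 * v)) ^ 2 := by
  simp only [WeierstrassCurve.Affine.addX, A_a₁, A_a₂]
  field_simp
  linear_combination (-8 * u - 8 * im) * heq + (-(16 * u ^ 2)) * him


/-- **Doubling, coordinate at `τ(1) = (0,0)`**: `x(2Q) = ((u² − 4)/(2v))²`. [cite: SilvermanAEC2009, III.2.3 (duplication formula)] -/
theorem A_addX_self {u v : K} (hv : v ≠ 0) (heq : v ^ 2 = u ^ 3 + 4 * u) :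
    (curveA.baseChange K).toAffine.addX u u ((3 * u ^ 2 + 4) / (2 * v)) = ((u ^ 2 - 4) / (2 * v)) ^ 2 := by
  simp only [WeierstrassCurve.Affine.addX, A_a₁, A_a₂]
  field_simp
  linear_combination (-8 * u) * heq

/-- **Translation by `τ(1) = (0,0)`**: the chord coordinates are `x = 4/u`, `y = −4v/u²`. [cite: SilvermanAEC2009, III.2.3] -/
theorem A_add_tauOne_coords {u v : K} (hu : u ≠ 0) (heq : v ^ 2 = u ^ 3 + 4 * u) :
    (curveA.baseChange K).toAffine.addX u 0 (v / u) = 4 / u ∧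
      (curveA.baseChange K).toAffine.addY u 0 v (v / u) = -(4 * v) / u ^ 2 := by
  simp only [WeierstrassCurve.Affine.addY, WeierstrassCurve.Affine.negAddY, WeierstrassCurve.Affine.addX,
    WeierstrassCurve.Affine.negY, A_a₁, A_a₂, A_a₃, sub_zero]
  constructor
  · field_simp
    linear_combination heq
  · field_simp
    linear_combination (-v) * heq

/-- **Translation by `T⁺ = (2i, 0)`**: the chord coordinates are `x = (2iu − 4)/(u − 2i)`, `y = 8v/(u − 2i)²`. [cite: SilvermanAEC2009, III.2.3] -/
theorem A_add_ptTwoI_coords {im u v : K} (him : im ^ 2 = -1) (hu : u ≠ 2 * im) (heq : v ^ 2 = u ^ 3 + 4 * u) :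
    (curveA.baseChange K).toAffine.addX u (2 * im) (v / (u - 2 * im)) = (2 * im * u - 4) / (u - 2 * im) ∧
      (curveA.baseChange K).toAffine.addY u (2 * im) v (v / (u - 2 * im)) = 8 * v / (u - 2 * im) ^ 2 := by
  have hu' : u - 2 * im ≠ 0 := sub_ne_zero.mpr hu
  simp only [WeierstrassCurve.Affine.addY, WeierstrassCurve.Affine.negAddY, WeierstrassCurve.Affine.addX,
    WeierstrassCurve.Affine.negY, A_a₁, A_a₂, A_a₃]
  constructor
  · field_simp
    linear_combination heq + (8 * u - 8 * im) * him
  · field_simp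
    linear_combination (-v) * heq + (-(12 * u * v) + 16 * v * im) * him

/-! ## §2 Point-level statements -/

/-- An affine point `(u, v)` of `A` with `v ≠ 0` is not `2`-torsion, and its abscissa avoids `0, ±2i`. [cite: TianYuanZhang2017, Lemma 3.16] -/
theorem A_X_ne_of_Y_ne {im u v : K} (him : im ^ 2 = -1) (h : (curveA.baseChange K).toAffine.Nonsingular u v) (hv : v ≠ 0) :
    u ≠ 0 ∧ u ≠ 2 * im ∧ u ≠ -(2 * im) := by
  have heq : v ^ 2 = u ^ 3 + 4 * u := (curveA_nonsingular_iff u v).mp h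
  refine ⟨fun hu => hv ?_, fun hu => hv ?_, fun hu => hv ?_⟩
  · have : v ^ 2 = 0 := by rw [heq, hu]; ring
    exact pow_eq_zero_iff two_ne_zero |>.mp this
  · have : v ^ 2 = 0 := by rw [heq, hu]; linear_combination (8 * im) * him
    exact pow_eq_zero_iff two_ne_zero |>.mp this
  · have : v ^ 2 = 0 := by rw [heq, hu]; linear_combination (-(8 * im)) * him
    exact pow_eq_zero_iff two_ne_zero |>.mp this


/-- Transport of an affine point along equal coordinates. [folklore] -/
theorem exists_some_eq {x y x' y' : K} (h : (curveA.baseChange K).toAffine.Nonsingular x y) (hx : x = x') (hy : y = y') :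
    ∃ h' : (curveA.baseChange K).toAffine.Nonsingular x' y', (Point.some x y h : APoint K) = Point.some x' y' h' := by
  subst hx; subst hy; exact ⟨h, rfl⟩

/-- **`x(2Q) − 2i` is the square of `g⁺(Q) = (u² − 4iu + 4)/(2v)`**: if `Q = (u, v)` with `v ≠ 0` and `2Q = (X, Y)`, then `X − 2i = g⁺(Q)²`.
[cite: SilvermanAEC2009, III.2.3, Prop. X.1.4 (proof)] -/
theorem X_two_smul_sub_twoIm {im u v X Y : K} (him : im ^ 2 = -1) (h : (curveA.baseChange K).toAffine.Nonsingular u v) (hv : v ≠ 0)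
    (hX : (curveA.baseChange K).toAffine.Nonsingular X Y)
    (h2 : (2 : ℕ) • (Point.some u v h : APoint K) = Point.some X Y hX) :
    X - 2 * im = ((u ^ 2 - 4 * im * u + 4) / (2 * v)) ^ 2 := by
  have heq : v ^ 2 = u ^ 3 + 4 * u := (curveA_nonsingular_iff u v).mp h
  have hv' : v ≠ (curveA.baseChange K).toAffine.negY u v := by
    rw [curveA_negY]; intro e; exact hv (CharZero.eq_neg_self_iff.mp e)
  rw [two_nsmul, add_self_of_Y_ne hv'] at h2
  have hX' : X = (curveA.baseChange K).toAffine.addX u u ((curveA.baseChange K).toAffine.slope u u v v) :=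
    ((Point.some.injEq _ _ _ _ _ _).mp h2).1.symm
  rw [hX', A_slope_self hv, A_addX_self_sub_twoIm him hv heq]


/-- **`x(2Q)` is the square of `g⁰(Q) = (u² − 4)/(2v)`**: if `Q = (u, v)` with `v ≠ 0` and `2Q = (X, Y)`, then `X = g⁰(Q)²`.
[cite: SilvermanAEC2009, III.2.3, Prop. X.1.4 (proof)] -/
theorem X_two_smul_eq_sq {im u v X Y : K} (him : im ^ 2 = -1) (h : (curveA.baseChange K).toAffine.Nonsingular u v) (hv : v ≠ 0)
    (hX : (curveA.baseChange K).toAffine.Nonsingular X Y)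
    (h2 : (2 : ℕ) • (Point.some u v h : APoint K) = Point.some X Y hX) :
    X - 0 = ((u ^ 2 - 4) / (2 * v)) ^ 2 := by
  have _ := him
  have heq : v ^ 2 = u ^ 3 + 4 * u := (curveA_nonsingular_iff u v).mp h
  have hv' : v ≠ (curveA.baseChange K).toAffine.negY u v := by
    rw [curveA_negY]; intro e; exact hv (CharZero.eq_neg_self_iff.mp e)
  rw [two_nsmul, add_self_of_Y_ne hv'] at h2
  have hX' : X = (curveA.baseChange K).toAffine.addX u u ((curveA.baseChange K).toAffine.slope u u v v) :=
    ((Point.some.injEq _ _ _ _ _ _).mp h2).1.symm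
  rw [sub_zero, hX', A_slope_self hv, A_addX_self hv heq]

/-- **Translation by `τ(1)` in coordinates**: `(u, v) + (0, 0) = (4/u, −4v/u²)` (`v ≠ 0`). [cite: SilvermanAEC2009, III.2.3] -/
theorem add_tauOne_eq {im u v : K} (him : im ^ 2 = -1) (h : (curveA.baseChange K).toAffine.Nonsingular u v) (hv : v ≠ 0) :
    ∃ h' : (curveA.baseChange K).toAffine.Nonsingular (4 / u) (-(4 * v) / u ^ 2),
      (Point.some u v h : APoint K) + tauOne = Point.some (4 / u) (-(4 * v) / u ^ 2) h' := by
  have heq : v ^ 2 = u ^ 3 + 4 * u := (curveA_nonsingular_iff u v).mp h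
  have hu : u ≠ 0 := (A_X_ne_of_Y_ne him h hv).1
  obtain ⟨hx, hy⟩ := A_add_tauOne_coords hu heq
  have h0 : (curveA.baseChange K).toAffine.Nonsingular 0 0 := (curveA_nonsingular_iff (0 : K) 0).mpr (by ring)
  have hadd : (Point.some u v h : APoint K) + tauOne =
      Point.some ((curveA.baseChange K).toAffine.addX u 0 ((curveA.baseChange K).toAffine.slope u 0 v 0))
        ((curveA.baseChange K).toAffine.addY u 0 v ((curveA.baseChange K).toAffine.slope u 0 v 0))
        (nonsingular_add h h0 fun hxy => hu hxy.left) := by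
    rw [tauOne]; exact add_of_X_ne hu
  have hs : (curveA.baseChange K).toAffine.slope u 0 v 0 = v / u := by rw [slope_of_X_ne hu, sub_zero, sub_zero]
  have hx' : (curveA.baseChange K).toAffine.addX u 0 ((curveA.baseChange K).toAffine.slope u 0 v 0) = 4 / u := by rw [hs]; exact hx
  have hy' : (curveA.baseChange K).toAffine.addY u 0 v ((curveA.baseChange K).toAffine.slope u 0 v 0) = -(4 * v) / u ^ 2 := by
    rw [hs]; exact hy
  obtain ⟨h', e⟩ := exists_some_eq _ hx' hy'
  exact ⟨h', hadd.trans e⟩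

/-- **Translation by `T⁺ = (2i, 0)` in coordinates**: `(u, v) + (2i, 0) = ((2iu − 4)/(u − 2i), 8v/(u − 2i)²)` (`v ≠ 0`). [cite: SilvermanAEC2009, III.2.3] -/
theorem add_ptTwoI_eq {im u v : K} (him : im ^ 2 = -1) (h : (curveA.baseChange K).toAffine.Nonsingular u v) (hv : v ≠ 0) :
    ∃ h' : (curveA.baseChange K).toAffine.Nonsingular ((2 * im * u - 4) / (u - 2 * im)) (8 * v / (u - 2 * im) ^ 2),
      (Point.some u v h : APoint K) + ptTwoI im him = Point.some ((2 * im * u - 4) / (u - 2 * im)) (8 * v / (u - 2 * im) ^ 2) h' := by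
  have heq : v ^ 2 = u ^ 3 + 4 * u := (curveA_nonsingular_iff u v).mp h
  have hu : u ≠ 2 * im := (A_X_ne_of_Y_ne him h hv).2.1
  obtain ⟨hx, hy⟩ := A_add_ptTwoI_coords him hu heq
  have h0 : (curveA.baseChange K).toAffine.Nonsingular (2 * im) 0 :=
    (curveA_nonsingular_iff _ _).mpr (by linear_combination (-8 * im) * him)
  have hadd : (Point.some u v h : APoint K) + ptTwoI im him =
      Point.some ((curveA.baseChange K).toAffine.addX u (2 * im) ((curveA.baseChange K).toAffine.slope u (2 * im) v 0))
        ((curveA.baseChange K).toAffine.addY u (2 * im) v ((curveA.baseChange K).toAffine.slope u (2 * im) v 0))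
        (nonsingular_add h h0 fun hxy => hu hxy.left) := by
    rw [ptTwoI]; exact add_of_X_ne hu
  have hs : (curveA.baseChange K).toAffine.slope u (2 * im) v 0 = v / (u - 2 * im) := by rw [slope_of_X_ne hu, sub_zero]
  have hx' : (curveA.baseChange K).toAffine.addX u (2 * im) ((curveA.baseChange K).toAffine.slope u (2 * im) v 0) =
      (2 * im * u - 4) / (u - 2 * im) := by rw [hs]; exact hx
  have hy' : (curveA.baseChange K).toAffine.addY u (2 * im) v ((curveA.baseChange K).toAffine.slope u (2 * im) v 0) =
      8 * v / (u - 2 * im) ^ 2 := by rw [hs]; exact hy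
  obtain ⟨h', e⟩ := exists_some_eq _ hx' hy'
  exact ⟨h', hadd.trans e⟩

/-- `τ(1) + T⁺ = T⁻`: `(0,0) + (2i,0) = (−2i,0)`. [cite: TianYuanZhang2017, Lemma 3.16 (p0017 L98–L101)] -/
theorem tauOne_add_ptTwoI {im : K} (him : im ^ 2 = -1) : (tauOne : APoint K) + ptTwoI im him = ptNegTwoI im him := by
  have hi : im ≠ 0 := by intro h; rw [h] at him; norm_num at him
  have hne : (0 : K) ≠ 2 * im := by
    intro h; exact hi (by linear_combination (-(1:K)/2) * h)
  rw [tauOne, ptTwoI, add_of_X_ne hne, ptNegTwoI]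
  congr 1
  · simp only [WeierstrassCurve.Affine.addX, slope_of_X_ne hne, A_a₁, A_a₂]; ring
  · simp only [WeierstrassCurve.Affine.addY, WeierstrassCurve.Affine.negAddY, WeierstrassCurve.Affine.addX,
      WeierstrassCurve.Affine.negY, slope_of_X_ne hne, A_a₁, A_a₂, A_a₃]; ring

/-! ## §3 The sign character of `g⁺` under translation by `A[2]` -/

/-- **`g⁺(Q + τ(1)) = −g⁺(Q)`** in coordinates. [cite: SilvermanAEC2009, Prop. X.1.4 (proof), III.8 (Weil pairing e₂(τ(1), T⁺) = −1)] -/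
theorem gPlus_add_tauOne {im u v : K} (him : im ^ 2 = -1) (h : (curveA.baseChange K).toAffine.Nonsingular u v) (hv : v ≠ 0) :
    ((4 / u) ^ 2 - 4 * im * (4 / u) + 4) / (2 * (-(4 * v) / u ^ 2)) = -((u ^ 2 - 4 * im * u + 4) / (2 * v)) := by
  have hu : u ≠ 0 := (A_X_ne_of_Y_ne him h hv).1
  field_simp
  ring

/-- **`g⁺(Q + T⁺) = g⁺(Q)`** in coordinates. [cite: SilvermanAEC2009, Prop. X.1.4 (proof), III.8 (e₂(T⁺, T⁺) = 1)] -/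
theorem gPlus_add_ptTwoI {im u v : K} (him : im ^ 2 = -1) (h : (curveA.baseChange K).toAffine.Nonsingular u v) (hv : v ≠ 0) :
    (((2 * im * u - 4) / (u - 2 * im)) ^ 2 - 4 * im * ((2 * im * u - 4) / (u - 2 * im)) + 4) / (2 * (8 * v / (u - 2 * im) ^ 2)) =
      (u ^ 2 - 4 * im * u + 4) / (2 * v) := by
  have hu : u - 2 * im ≠ 0 := sub_ne_zero.mpr (A_X_ne_of_Y_ne him h hv).2.1
  field_simp
  linear_combination (-16 - 4 * u ^ 2 + 16 * im * u) * him


/-- **`g⁰(Q + τ(1)) = g⁰(Q)`** in coordinates. [cite: SilvermanAEC2009, Prop. X.1.4 (proof), III.8 (e₂(τ(1), τ(1)) = 1)] -/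
theorem gZero_add_tauOne {im u v : K} (him : im ^ 2 = -1) (h : (curveA.baseChange K).toAffine.Nonsingular u v) (hv : v ≠ 0) :
    ((4 / u) ^ 2 - 4) / (2 * (-(4 * v) / u ^ 2)) = (u ^ 2 - 4) / (2 * v) := by
  have hu : u ≠ 0 := (A_X_ne_of_Y_ne him h hv).1
  field_simp
  ring

/-- **`g⁰(Q + T⁺) = −g⁰(Q)`** in coordinates. [cite: SilvermanAEC2009, Prop. X.1.4 (proof), III.8 (e₂(T⁺, τ(1)) = −1)] -/
theorem gZero_add_ptTwoI {im u v : K} (him : im ^ 2 = -1) (h : (curveA.baseChange K).toAffine.Nonsingular u v) (hv : v ≠ 0) :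
    (((2 * im * u - 4) / (u - 2 * im)) ^ 2 - 4) / (2 * (8 * v / (u - 2 * im) ^ 2)) = -((u ^ 2 - 4) / (2 * v)) := by
  have hu : u - 2 * im ≠ 0 := sub_ne_zero.mpr (A_X_ne_of_Y_ne him h hv).2.1
  field_simp
  linear_combination (4 * u ^ 2 - 16) * him

/-! ## §5 Halving over an algebraically closed field -/

section Halving

variable {Ω : Type} [Field Ω] [CharZero Ω]

/-- `A/Ω` is an elliptic curve. [folklore] -/
theorem isElliptic_over : (curveA.baseChange Ω).IsElliptic := inferInstanceAs (curveA.map (algebraMap ℚ Ω)).IsElliptic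

/-- `A/Ω` has the rational `2`-torsion abscissae `2i, 0, −2i`. [cite: SilvermanAEC2009, Prop. X.1.4] -/
theorem splitTwoTorsion_over' {im : Ω} (him : im ^ 2 = -1) :
    (curveA.baseChange Ω).toAffine.SplitTwoTorsion (2 * im) 0 (-(2 * im)) := by
  have hb₂ : (curveA.baseChange Ω).toAffine.b₂ = 0 := by
    simp [WeierstrassCurve.b₂, curveA, WeierstrassCurve.baseChange]
  have hb₄ : (curveA.baseChange Ω).toAffine.b₄ = 8 := by
    simp [WeierstrassCurve.b₄, curveA, WeierstrassCurve.baseChange]; norm_num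
  have hb₆ : (curveA.baseChange Ω).toAffine.b₆ = 0 := by
    simp [WeierstrassCurve.b₆, curveA, WeierstrassCurve.baseChange]
  refine ⟨?_, ?_, ?_⟩
  · rw [hb₂]; ring
  · rw [hb₄]; linear_combination (8 : Ω) * him
  · rw [hb₆]; ring

omit [CharZero Ω] in
/-- In an algebraically closed field every square class is trivial. [folklore] -/
theorem sqUnits_eq_one [IsAlgClosed Ω] (c : SqUnits Ω) : c = 1 := by
  induction c using QuotientGroup.induction_on with
  | H u =>
    rw [QuotientGroup.eq_one_iff]
    obtain ⟨v, hv⟩ := IsAlgClosed.exists_pow_nat_eq (u : Ω) two_pos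
    have hv0 : v ≠ 0 := fun h0 => u.ne_zero (by rw [← hv, h0]; ring)
    exact ⟨Units.mk0 v hv0, Units.ext (by simp [hv])⟩

/-- **Over an algebraically closed field every point of `A` is `2`-divisible** (complete `2`-descent: the Kummer classes are trivial).
[cite: SilvermanAEC2009, Prop. X.1.4] -/
theorem exists_two_smul_eq [IsAlgClosed Ω] {im : Ω} (him : im ^ 2 = -1) (P : APoint Ω) : ∃ Q : APoint Ω, (2 : ℕ) • Q = P := by
  haveI := isElliptic_over (Ω := Ω)
  obtain ⟨Q, hQ⟩ := exists_add_self_of_twoDescentComponent_eq_one (splitTwoTorsion_over' him) P (sqUnits_eq_one _)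
    (sqUnits_eq_one _)
  exact ⟨Q, by rw [two_nsmul]; exact hQ⟩

end Halving

end Summit.BirchSwinnertonDyer.PrintCf2.GenusPeriodTraceNorm

end
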